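import Summits.AnomalousDissipation.AnomalousDissipation.Theorems.SawtoothPulseCascadeK1LocalisedCascadePeriodicSieve
import Summits.AnomalousDissipation.AnomalousDissipation.Theorems.SawtoothPulseCascadeK1LocalisedCascadeFibreWindowL2

/-!
# K1loc, line `Spectral` / thin start — helper: THE WINDOW LEMMA, PERIODIC-SIEVE FORM (S-D, «FibreWindowSieve»)

Helper file of the prover lane on the crux `K1LocalisedCascade` (stmt-AnomalousDissipation-19491), route
`SawtoothPulseCascade` (S-D fibre ledger).  Third form of the mid-band term of the window lemma on the two-torus, beside
`…FibreWindow` (pointwise majorant of `g^mid`) and `…FibreWindowL2` (fibrewise `L²` mass of `g^mid` × SUP of the fibre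
coefficient `A^i_nθ₁`): here the mid-band cut-offs `g^mid_n` are `1/N`-PERIODIC (the phase-`j` profile has `N_j` identical
teeth) and the tracked input `θ₁` has its spectrum in the slab `|k_j| ≤ K`; then NO sup norm is needed:
* §1 `twistedAxisAvg_eq_fibreSum`: on `𝕋²`, `A^i_nθ₁(x) = e_n(x_i)·Σ_{|m|≤K} 𝓕θ₁(n e_i + m e_j) e_m(x_j)` (the fibre function is a
  trigonometric polynomial of degree `≤ K` in `x_j`), and `sum_sq_norm_fibreCoeff_le_integral` (Bessel on the slab);
* §2 **`sum_sq_norm_mid_le_sieve`**: `Σ_{k∈W}‖𝓕(g^mid_{k_i}(x_j)A^i_{k_i}θ₁)(k)‖² ≤ (1 + 2K/N)·Σ_{n∈F} E_n·∫‖A^i_nθ₁‖²`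
  (`∫_𝕋‖g^mid_n‖² ≤ E_n`; `…PeriodicSieve.integral_periodic_mul_sq_norm_trigPoly_le` on each fibre);
* §3 **`sum_window_sq_norm_comp_shearMap_le_sieve`**: the window lemma with this mid-band term,
  `Σ_{k∈W}‖𝓕((θ₁+θ₂)∘Φ)(k)‖² ≤ (√((1 + 2K/N)·Σ_{n∈F}E_n∫‖A^i_nθ₁‖²) + √(Σ_{n∈F}∫‖A^i_nθ₂‖²))²`.
Relative to the tracked `L²` energy; the constant `1 + 2K/N_j` replaces `C_eq`/`S_n²` of the fibre-`L²` form.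
No definitions; nothing about the crux. [cite: Grafakos2014, Prop. 3.1.2 (5) and Prop. 3.2.7 (3)] [problem: turb]
-/

-- `Summit.<Summit>.<Problem>`: single-conjunct summit, the duplicate namespace segment is deliberate.
set_option linter.dupNamespace false

noncomputable section

namespace Summit.AnomalousDissipation.AnomalousDissipation.Theorems.SawtoothPulseCascade.K1Window

open MeasureTheory Set Filter Topology UnitAddTorus Function Complex
open scoped Real
open Literature.Analysis Literature.Analysis.FunctionSpaces Literature.Analysis.FunctionSpaces.Torus Literature.Analysis.FluidPDE
open Summit.AnomalousDissipation.AnomalousDissipation.Theorems.SawtoothPulseCascade.K1Start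

/-! ## §1 The fibre function on the two-torus -/

/-- On `Fin 2`, the index different from `i` is `j` (`i ≠ j`). [folklore] -/
theorem fin_two_eq_of_ne {i j l : Fin 2} (hij : i ≠ j) (hl : l ≠ i) : l = j := by
  fin_cases i <;> fin_cases j <;> fin_cases l <;> simp_all

/-- The exponential monomial of the lattice point `n e_i + m e_j` on `𝕋²` factorises: `e_{(n,m)}(x) = e_n(x_i)·e_m(x_j)`.
[folklore] -/
theorem mFourier_update_apply {i j : Fin 2} (hij : i ≠ j) (n m : ℤ) (x : UnitAddTorus (Fin 2)) :
    mFourier (Function.update (fun _ : Fin 2 => m) i n) x = fourier n (x i) * fourier m (x j) := by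
  have h : (mFourier (Function.update (fun _ : Fin 2 => m) i n)) x =
      ∏ l : Fin 2, fourier ((Function.update (fun _ : Fin 2 => m) i n) l) (x l) := rfl
  rw [h, Fin.prod_univ_two]
  fin_cases i <;> fin_cases j
  · exact absurd rfl hij
  · simp
  · simp [mul_comm]
  · exact absurd rfl hij

/-- **The fibre function is a trigonometric polynomial.**  On `𝕋²`, for continuous `θ₁` with absolutely summable coefficients
supported in the slab `|k_j| ≤ K` (`i ≠ j`): `A^i_nθ₁(x) = ∫e_{−n}(s)θ₁(x + se_i)ds = e_n(x_i)·Σ_{|m|≤K} 𝓕θ₁(n e_i + m e_j)·e_m(x_j)`.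
[cite: Grafakos2014, Prop. 3.1.2 (5) and Prop. 3.2.7 (3)] -/
theorem twistedAxisAvg_eq_fibreSum {θ₁ : UnitAddTorus (Fin 2) → ℂ} (hθ₁ : Continuous θ₁)
    (hθ₁s : Summable fun k => ‖mFourierCoeff θ₁ k‖) {i j : Fin 2} (hij : i ≠ j) {K : ℕ}
    (hK : ∀ k, mFourierCoeff θ₁ k ≠ 0 → |k j| ≤ K) (n : ℤ) (x : UnitAddTorus (Fin 2)) :
    ∫ s : UnitAddCircle, (fourier (-n) s : ℂ) • θ₁ (x + Pi.single i s) =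
      fourier n (x i) * ∑ m ∈ Finset.Icc (-(K : ℤ)) K,
        mFourierCoeff θ₁ (Function.update (fun _ : Fin 2 => m) i n) * fourier m (x j) := by
  classical
  set A : UnitAddTorus (Fin 2) → ℂ := fun x => ∫ s : UnitAddCircle, (fourier (-n) s : ℂ) • θ₁ (x + Pi.single i s) with hA
  have hAc : Continuous A := continuous_twistedAxisAvg hθ₁ i n
  set F : C(UnitAddTorus (Fin 2), ℂ) := ⟨A, hAc⟩ with hF
  have hFA : (F : UnitAddTorus (Fin 2) → ℂ) = A := rfl
  have hsn : Summable fun k => ‖mFourierCoeff (F : UnitAddTorus (Fin 2) → ℂ) k‖ := by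
    rw [hFA]; exact summable_norm_mFourierCoeff_twistedAxisAvg hθ₁ hθ₁s i n
  have hs : Summable (mFourierCoeff (F : UnitAddTorus (Fin 2) → ℂ)) := .of_norm hsn
  have hser := hasSum_mFourier_series_apply_of_summable hs x
  have hcoefF : ∀ k, mFourierCoeff (F : UnitAddTorus (Fin 2) → ℂ) k = if k i = n then mFourierCoeff θ₁ k else 0 :=
    fun k => by rw [hFA, hA]; exact mFourierCoeff_twistedAxisAvg hθ₁ i n k
  -- the (finite) support of the series
  set u : ℤ → (Fin 2 → ℤ) := fun m => Function.update (fun _ : Fin 2 => m) i n with hu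
  have hui : ∀ m, u m i = n := fun m => by simp [hu]
  have huj : ∀ m, u m j = m := fun m => by simp [hu, hij.symm]
  have huinj : Function.Injective u := fun m m' h => by
    have := congrArg (fun k => k j) h; simpa only [huj] using this
  set S : Finset (Fin 2 → ℤ) := (Finset.Icc (-(K : ℤ)) K).image u with hS
  have hzero : ∀ k, k ∉ S → mFourierCoeff (F : UnitAddTorus (Fin 2) → ℂ) k • mFourier k x = 0 := by
    intro k hk
    rw [hcoefF]
    split_ifs with hki
    · by_cases h0 : mFourierCoeff θ₁ k = 0
      · rw [h0, zero_smul]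
      · exfalso
        have hkj : |k j| ≤ K := hK k h0
        have hku : k = u (k j) := by
          funext l
          by_cases hl : l = i
          · rw [hl, hui, hki]
          · rw [fin_two_eq_of_ne hij hl, huj]
        exact hk (Finset.mem_image.2 ⟨k j, Finset.mem_Icc.2 (abs_le.1 hkj), hku.symm⟩)
    · rw [zero_smul]
  have hfin : HasSum (fun k => mFourierCoeff (F : UnitAddTorus (Fin 2) → ℂ) k • mFourier k x)
      (∑ k ∈ S, mFourierCoeff (F : UnitAddTorus (Fin 2) → ℂ) k • mFourier k x) :=
    hasSum_sum_of_ne_finset_zero hzero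
  have hAx : A x = ∑ k ∈ S, mFourierCoeff (F : UnitAddTorus (Fin 2) → ℂ) k • mFourier k x := hser.unique hfin
  show A x = _
  rw [hAx, hS, Finset.sum_image fun m _ m' _ h => huinj h, Finset.mul_sum]
  refine Finset.sum_congr rfl fun m _ => ?_
  rw [hcoefF, if_pos (hui m), smul_eq_mul, hu, mFourier_update_apply hij]
  ring

/-- **Bessel on the slab**: `Σ_{|m|≤K} ‖𝓕θ₁(n e_i + m e_j)‖² ≤ ∫_{𝕋²} ‖A^i_nθ₁‖²` (the slab coefficients of `θ₁` are the
coefficients of the fibre piece `A^i_nθ₁`, `…StripBlock.mFourierCoeff_twistedAxisAvg`). [cite: Grafakos2014, Prop. 3.2.7 (3)] -/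
theorem sum_sq_norm_fibreCoeff_le_integral {θ₁ : UnitAddTorus (Fin 2) → ℂ} (hθ₁ : Continuous θ₁) {i j : Fin 2}
    (hij : i ≠ j) (K : ℕ) (n : ℤ) :
    ∑ m ∈ Finset.Icc (-(K : ℤ)) K, ‖mFourierCoeff θ₁ (Function.update (fun _ : Fin 2 => m) i n)‖ ^ 2 ≤
      ∫ x : UnitAddTorus (Fin 2), ‖∫ s : UnitAddCircle, (fourier (-n) s : ℂ) • θ₁ (x + Pi.single i s)‖ ^ 2 := by
  classical
  set u : ℤ → (Fin 2 → ℤ) := fun m => Function.update (fun _ : Fin 2 => m) i n with hu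
  have hui : ∀ m, u m i = n := fun m => by simp [hu]
  have huj : ∀ m, u m j = m := fun m => by simp [hu, hij.symm]
  have huinj : Function.Injective u := fun m m' h => by
    have := congrArg (fun k => k j) h; simpa only [huj] using this
  have hAc : Continuous fun x : UnitAddTorus (Fin 2) =>
      ∫ s : UnitAddCircle, (fourier (-n) s : ℂ) • θ₁ (x + Pi.single i s) := continuous_twistedAxisAvg hθ₁ i n
  have h1 : ∑ m ∈ Finset.Icc (-(K : ℤ)) K, ‖mFourierCoeff θ₁ (u m)‖ ^ 2 =
      ∑ k ∈ (Finset.Icc (-(K : ℤ)) K).image u, ‖mFourierCoeff (fun x : UnitAddTorus (Fin 2) =>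
        ∫ s : UnitAddCircle, (fourier (-n) s : ℂ) • θ₁ (x + Pi.single i s)) k‖ ^ 2 := by
    rw [Finset.sum_image fun m _ m' _ h => huinj h]
    refine Finset.sum_congr rfl fun m _ => ?_
    rw [mFourierCoeff_twistedAxisAvg hθ₁ i n (u m), if_pos (hui m)]
  rw [show (fun m => Function.update (fun _ : Fin 2 => m) i n) = u from rfl] at *
  rw [h1]
  exact sum_sq_norm_mFourierCoeff_le_integral hAc _

/-! ## §2 The mid-band term, periodic-sieve form -/

/-- **Mid-band term, periodic-sieve form.**  On `𝕋²` (`i ≠ j`): if `θ₁` is continuous with absolutely summable coefficients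
supported in the slab `|k_j| ≤ K`, the cut-offs `g^mid_n` are continuous and `1/N`-periodic (`N ≥ 1`) with
`∫_𝕋‖g^mid_n‖² ≤ E_n` on the fibres met by `W`, then
`Σ_{k∈W}‖𝓕(g^mid_{k_i}(x_j)·A^i_{k_i}θ₁)(k)‖² ≤ (1 + 2K/N)·Σ_{n∈F} E_n·∫‖A^i_nθ₁‖²` (`F` = fibres met by `W`):
Bessel on each fibre, the fibre function is a trigonometric polynomial of degree `≤ K` in `x_j` (§1), and
`…PeriodicSieve.integral_periodic_mul_sq_norm_trigPoly_le`. [cite: Grafakos2014, Prop. 3.1.2 (5) and Prop. 3.2.7 (3)] -/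
theorem sum_sq_norm_mid_le_sieve {θ₁ : UnitAddTorus (Fin 2) → ℂ} (hθ₁ : Continuous θ₁)
    (hθ₁s : Summable fun k => ‖mFourierCoeff θ₁ k‖) {i j : Fin 2} (hij : i ≠ j) {K : ℕ}
    (hK : ∀ k, mFourierCoeff θ₁ k ≠ 0 → |k j| ≤ K) (W : Finset (Fin 2 → ℤ)) (gmid : ℤ → UnitAddCircle → ℂ)
    (hgmid : ∀ n, Continuous (gmid n)) {N : ℕ} (hN : 0 < N)
    (hper : ∀ n (y : UnitAddCircle), gmid n (y + (((1 : ℝ) / N : ℝ) : UnitAddCircle)) = gmid n y) {E : ℤ → ℝ}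
    (hE : ∀ k ∈ W, ∫ b : UnitAddCircle, ‖gmid (k i) b‖ ^ 2 ≤ E (k i)) :
    ∑ k ∈ W, ‖mFourierCoeff (fun x => gmid (k i) (x j) *
        ∫ s : UnitAddCircle, (fourier (-(k i)) s : ℂ) • θ₁ (x + Pi.single i s)) k‖ ^ 2 ≤
      (1 + 2 * (K : ℝ) / N) * ∑ n ∈ W.image (fun k => k i),
        E n * ∫ x : UnitAddTorus (Fin 2), ‖∫ s : UnitAddCircle, (fourier (-n) s : ℂ) • θ₁ (x + Pi.single i s)‖ ^ 2 := by
  classical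
  have hNr : (0 : ℝ) < N := by exact_mod_cast hN
  set A₁ : ℤ → UnitAddTorus (Fin 2) → ℂ := fun n x =>
    ∫ s : UnitAddCircle, (fourier (-n) s : ℂ) • θ₁ (x + Pi.single i s) with hA₁
  set H₁ : ℤ → UnitAddTorus (Fin 2) → ℂ := fun n x => gmid n (x j) * A₁ n x with hH₁
  have hA₁c : ∀ n, Continuous (A₁ n) := fun n => continuous_twistedAxisAvg hθ₁ i n
  have hH₁c : ∀ n, Continuous (H₁ n) := fun n => ((hgmid n).comp (continuous_apply j)).mul (hA₁c n)
  set F : Finset ℤ := W.image fun k => k i with hF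
  have hmaps : ∀ k ∈ W, k i ∈ F := fun k hk => Finset.mem_image_of_mem _ hk
  -- Bessel on each fibre
  have hfib : ∑ k ∈ W, ‖mFourierCoeff (H₁ (k i)) k‖ ^ 2 ≤ ∑ n ∈ F, ∫ x : UnitAddTorus (Fin 2), ‖H₁ n x‖ ^ 2 := by
    rw [← Finset.sum_fiberwise_of_maps_to hmaps]
    refine Finset.sum_le_sum fun n hn => ?_
    calc ∑ k ∈ W with k i = n, ‖mFourierCoeff (H₁ (k i)) k‖ ^ 2
        = ∑ k ∈ W with k i = n, ‖mFourierCoeff (H₁ n) k‖ ^ 2 :=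
          Finset.sum_congr rfl fun k hk => by rw [(Finset.mem_filter.mp hk).2]
      _ ≤ ∫ x : UnitAddTorus (Fin 2), ‖H₁ n x‖ ^ 2 := sum_sq_norm_mFourierCoeff_le_integral (hH₁c n) _
  have hEF : ∀ n ∈ F, ∫ b : UnitAddCircle, ‖gmid n b‖ ^ 2 ≤ E n := by
    intro n hn; obtain ⟨k, hk, rfl⟩ := Finset.mem_image.mp hn; exact hE k hk
  -- the slab data
  set M : Finset ℤ := Finset.Icc (-(K : ℤ)) K with hM
  have hMK : ∀ m ∈ M, |m| ≤ K := fun m hm => abs_le.2 (Finset.mem_Icc.1 hm)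
  set a : ℤ → ℤ → ℂ := fun n m => mFourierCoeff θ₁ (Function.update (fun _ : Fin 2 => m) i n) with ha
  -- on each fibre: `∫‖H₁ n‖² = ∫_𝕋 ‖g^mid_n‖²‖c_n‖² ≤ (1 + 2K/N) E_n Σ_m ‖a_{n,m}‖² ≤ (1 + 2K/N) E_n ∫‖A^i_nθ₁‖²`
  have hle : ∀ n ∈ F, ∫ x : UnitAddTorus (Fin 2), ‖H₁ n x‖ ^ 2 ≤
      (1 + 2 * (K : ℝ) / N) * (E n * ∫ x : UnitAddTorus (Fin 2), ‖A₁ n x‖ ^ 2) := by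
    intro n hn
    have hfibre : ∀ x : UnitAddTorus (Fin 2), A₁ n x = fourier n (x i) * ∑ m ∈ M, a n m * fourier m (x j) :=
      fun x => twistedAxisAvg_eq_fibreSum hθ₁ hθ₁s hij hK n x
    set G : UnitAddCircle → ℝ := fun y => ‖gmid n y‖ ^ 2 * ‖∑ m ∈ M, a n m * fourier m y‖ ^ 2 with hG
    have hcc : Continuous fun y : UnitAddCircle => ∑ m ∈ M, a n m * fourier m y :=
      continuous_finsetSum _ fun m _ => continuous_const.mul (fourier m).continuous
    have hGc : Continuous G := ((continuous_norm.comp (hgmid n)).pow 2).mul ((continuous_norm.comp hcc).pow 2)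
    have hHG : ∀ x : UnitAddTorus (Fin 2), ‖H₁ n x‖ ^ 2 = G (x j) := by
      intro x
      simp only [hH₁, hG, hfibre x, norm_mul, mul_pow]
      have h1 : ‖(fourier n (x i) : ℂ)‖ = 1 := Circle.norm_coe _
      rw [h1, one_pow, one_mul]
    have hw : ∀ y : UnitAddCircle, (fun y => ‖gmid n y‖ ^ 2) (y + (((1 : ℝ) / N : ℝ) : UnitAddCircle)) =
        (fun y => ‖gmid n y‖ ^ 2) y := fun y => by simp only [hper n y]
    have hsieve := integral_periodic_mul_sq_norm_trigPoly_le (w := fun y => ‖gmid n y‖ ^ 2) hN M hMK (a n)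
      ((hgmid n).norm.pow 2) (fun y => sq_nonneg _) hw
    have hE0 : 0 ≤ E n := (integral_nonneg fun b => sq_nonneg _).trans (hEF n hn)
    have hK0 : 0 ≤ 1 + 2 * (K : ℝ) / N := by positivity
    have hBessel : ∑ m ∈ M, ‖a n m‖ ^ 2 ≤ ∫ x : UnitAddTorus (Fin 2), ‖A₁ n x‖ ^ 2 :=
      sum_sq_norm_fibreCoeff_le_integral hθ₁ hij K n
    calc ∫ x : UnitAddTorus (Fin 2), ‖H₁ n x‖ ^ 2 = ∫ x : UnitAddTorus (Fin 2), G (x j) :=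
          integral_congr_ae (Eventually.of_forall hHG)
      _ = ∫ y : UnitAddCircle, G y := K1Flat.integral_comp_eval_eq_integral_circle (d := Fin 2) hGc j
      _ = ∫ y : UnitAddCircle, ‖gmid n y‖ ^ 2 * ‖∑ m ∈ M, a n m * fourier m y‖ ^ 2 := rfl
      _ ≤ (1 + 2 * (K : ℝ) / N) * (∫ y : UnitAddCircle, ‖gmid n y‖ ^ 2) * ∑ m ∈ M, ‖a n m‖ ^ 2 := hsieve
      _ ≤ (1 + 2 * (K : ℝ) / N) * E n * ∫ x : UnitAddTorus (Fin 2), ‖A₁ n x‖ ^ 2 :=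
          mul_le_mul (mul_le_mul_of_nonneg_left (hEF n hn) hK0) hBessel (Finset.sum_nonneg fun m _ => sq_nonneg _)
            (mul_nonneg hK0 hE0)
      _ = (1 + 2 * (K : ℝ) / N) * (E n * ∫ x : UnitAddTorus (Fin 2), ‖A₁ n x‖ ^ 2) := by ring
  calc ∑ k ∈ W, ‖mFourierCoeff (H₁ (k i)) k‖ ^ 2 ≤ ∑ n ∈ F, ∫ x : UnitAddTorus (Fin 2), ‖H₁ n x‖ ^ 2 := hfib
    _ ≤ ∑ n ∈ F, (1 + 2 * (K : ℝ) / N) * (E n * ∫ x : UnitAddTorus (Fin 2), ‖A₁ n x‖ ^ 2) := Finset.sum_le_sum hle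
    _ = (1 + 2 * (K : ℝ) / N) * ∑ n ∈ F, E n * ∫ x : UnitAddTorus (Fin 2), ‖A₁ n x‖ ^ 2 := by
        rw [Finset.mul_sum]

/-! ## §3 The window lemma, periodic-sieve form -/

/-- **THE WINDOW LEMMA, periodic-sieve mid-band form** (two-torus).  Data as in
`…FibreWindowL2.sum_window_sq_norm_comp_shearMap_le_fibreL2` (transversal shear `Φ = shearMap i j φ`, finite window `W`,
input split `θ = θ₁ + θ₂`, chirp split `g_n = g^mid_n + g^rest_n` with exact separation, `∫‖g^mid_n‖² ≤ E_n`), but instead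
of a sup bound on the fibre coefficient of `θ₁` one supplies: the spectrum of `θ₁` lies in the slab `|k_j| ≤ K` and every
`g^mid_n` is `1/N`-periodic (`N ≥ 1`).  Then
`Σ_{k∈W}‖𝓕((θ₁+θ₂)∘Φ)(k)‖² ≤ (√((1 + 2K/N)·Σ_{n∈F}E_n∫‖A^i_nθ₁‖²) + √(Σ_{n∈F}∫‖A^i_nθ₂‖²))²`.
[cite: Grafakos2014, Prop. 3.1.2 (5) and Prop. 3.2.7 (3)] -/
theorem sum_window_sq_norm_comp_shearMap_le_sieve {θ₁ θ₂ : UnitAddTorus (Fin 2) → ℂ} (hθ₁ : Continuous θ₁)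
    (hθ₁s : Summable fun k => ‖mFourierCoeff θ₁ k‖) (hθ₂ : Continuous θ₂) {i j : Fin 2} (hij : i ≠ j)
    {K : ℕ} (hK : ∀ k, mFourierCoeff θ₁ k ≠ 0 → |k j| ≤ K) (P : ShearProfile)
    (W : Finset (Fin 2 → ℤ)) (gmid grest : ℤ → UnitAddCircle → ℂ) (hgmid : ∀ n, Continuous (gmid n))
    (hgrest : ∀ n, Continuous (grest n)) (hsplit : ∀ k ∈ W, ∀ b, twist P (k i) b = gmid (k i) b + grest (k i) b)
    (hsep : ∀ k ∈ W, ∀ m : ℤ, fourierCoeff (grest (k i)) m * mFourierCoeff θ₁ (k - Pi.single j m) = 0)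
    {N : ℕ} (hN : 0 < N) (hper : ∀ n (y : UnitAddCircle), gmid n (y + (((1 : ℝ) / N : ℝ) : UnitAddCircle)) = gmid n y)
    {E : ℤ → ℝ} (hE : ∀ k ∈ W, ∫ b : UnitAddCircle, ‖gmid (k i) b‖ ^ 2 ≤ E (k i)) :
    ∑ k ∈ W, ‖mFourierCoeff ((fun x => θ₁ x + θ₂ x) ∘ shearMap i j P) k‖ ^ 2 ≤
      (Real.sqrt ((1 + 2 * (K : ℝ) / N) * ∑ n ∈ W.image (fun k => k i),
          E n * ∫ x : UnitAddTorus (Fin 2), ‖∫ s : UnitAddCircle, (fourier (-n) s : ℂ) • θ₁ (x + Pi.single i s)‖ ^ 2) +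
        Real.sqrt (∑ n ∈ W.image (fun k => k i),
          ∫ x : UnitAddTorus (Fin 2), ‖∫ s : UnitAddCircle, (fourier (-n) s : ℂ) • θ₂ (x + Pi.single i s)‖ ^ 2)) ^ 2 := by
  classical
  set H₁ : ℤ → UnitAddTorus (Fin 2) → ℂ := fun n x => gmid n (x j) *
    ∫ s : UnitAddCircle, (fourier (-n) s : ℂ) • θ₁ (x + Pi.single i s) with hH₁
  set H₂ : ℤ → UnitAddTorus (Fin 2) → ℂ := fun n x => twist P n (x j) *
    ∫ s : UnitAddCircle, (fourier (-n) s : ℂ) • θ₂ (x + Pi.single i s) with hH₂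
  have hH₂c : ∀ n, Continuous (H₂ n) := fun n =>
    ((continuous_twist P n).comp (continuous_apply j)).mul (continuous_twistedAxisAvg hθ₂ i n)
  have hcoef : ∀ k ∈ W, mFourierCoeff ((fun x => θ₁ x + θ₂ x) ∘ shearMap i j P) k =
      mFourierCoeff (H₁ (k i)) k + mFourierCoeff (H₂ (k i)) k := by
    intro k hk
    have hsum : ((fun x => θ₁ x + θ₂ x) ∘ shearMap i j P) = (θ₁ ∘ shearMap i j P) + (θ₂ ∘ shearMap i j P) := by
      funext x; rfl
    rw [hsum, Torus.mFourierCoeff_add (F := ℂ) ((hθ₁.comp (continuous_shearMap i j P)).integrable_unitAddTorus)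
      ((hθ₂.comp (continuous_shearMap i j P)).integrable_unitAddTorus),
      mFourierCoeff_comp_shearMap_eq_mid hθ₁ hθ₁s hij P (hgmid (k i)) (hgrest (k i)) k (hsplit k hk) (hsep k hk),
      mFourierCoeff_comp_shearMap_eq_chirp hθ₂ hij P k]
  have hM : ∑ k ∈ W, ‖mFourierCoeff ((fun x => θ₁ x + θ₂ x) ∘ shearMap i j P) k‖ ^ 2 ≤
      (Real.sqrt (∑ k ∈ W, ‖mFourierCoeff (H₁ (k i)) k‖ ^ 2) +
        Real.sqrt (∑ k ∈ W, ‖mFourierCoeff (H₂ (k i)) k‖ ^ 2)) ^ 2 := by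
    have h1 : ∑ k ∈ W, ‖mFourierCoeff ((fun x => θ₁ x + θ₂ x) ∘ shearMap i j P) k‖ ^ 2 ≤
        ∑ k ∈ W, (‖mFourierCoeff (H₁ (k i)) k‖ + ‖mFourierCoeff (H₂ (k i)) k‖) ^ 2 := by
      refine Finset.sum_le_sum fun k hk => ?_
      rw [hcoef k hk]
      exact pow_le_pow_left₀ (norm_nonneg _) (norm_add_le _ _) 2
    have h2 := SpectralLeakage.sqrt_sum_add_sq_le W (a := fun k => ‖mFourierCoeff (H₁ (k i)) k‖)
      (b := fun k => ‖mFourierCoeff (H₂ (k i)) k‖) (fun k _ => norm_nonneg _) (fun k _ => norm_nonneg _)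
    have h0 : 0 ≤ ∑ k ∈ W, (‖mFourierCoeff (H₁ (k i)) k‖ + ‖mFourierCoeff (H₂ (k i)) k‖) ^ 2 :=
      Finset.sum_nonneg fun k _ => sq_nonneg _
    calc ∑ k ∈ W, ‖mFourierCoeff ((fun x => θ₁ x + θ₂ x) ∘ shearMap i j P) k‖ ^ 2
        ≤ ∑ k ∈ W, (‖mFourierCoeff (H₁ (k i)) k‖ + ‖mFourierCoeff (H₂ (k i)) k‖) ^ 2 := h1
      _ = (Real.sqrt (∑ k ∈ W, (‖mFourierCoeff (H₁ (k i)) k‖ + ‖mFourierCoeff (H₂ (k i)) k‖) ^ 2)) ^ 2 :=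
          (Real.sq_sqrt h0).symm
      _ ≤ _ := pow_le_pow_left₀ (Real.sqrt_nonneg _) h2 2
  have hA := sum_sq_norm_mid_le_sieve hθ₁ hθ₁s hij hK W gmid hgmid hN hper hE
  have hB : ∑ k ∈ W, ‖mFourierCoeff (H₂ (k i)) k‖ ^ 2 ≤ ∑ n ∈ W.image (fun k => k i),
      ∫ x : UnitAddTorus (Fin 2), ‖∫ s : UnitAddCircle, (fourier (-n) s : ℂ) • θ₂ (x + Pi.single i s)‖ ^ 2 := by
    set F : Finset ℤ := W.image fun k => k i with hF
    have hmaps : ∀ k ∈ W, k i ∈ F := fun k hk => Finset.mem_image_of_mem _ hk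
    rw [← Finset.sum_fiberwise_of_maps_to hmaps]
    refine Finset.sum_le_sum fun n hn => ?_
    calc ∑ k ∈ W with k i = n, ‖mFourierCoeff (H₂ (k i)) k‖ ^ 2
        = ∑ k ∈ W with k i = n, ‖mFourierCoeff (H₂ n) k‖ ^ 2 :=
          Finset.sum_congr rfl fun k hk => by rw [(Finset.mem_filter.mp hk).2]
      _ ≤ ∫ x : UnitAddTorus (Fin 2), ‖H₂ n x‖ ^ 2 := sum_sq_norm_mFourierCoeff_le_integral (hH₂c n) _
      _ = ∫ x : UnitAddTorus (Fin 2), ‖∫ s : UnitAddCircle, (fourier (-n) s : ℂ) • θ₂ (x + Pi.single i s)‖ ^ 2 :=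
          integral_congr_ae (Eventually.of_forall fun x => by simp only [hH₂, norm_mul, norm_twist, one_mul])
  exact hM.trans (pow_le_pow_left₀ (by positivity) (add_le_add (Real.sqrt_le_sqrt hA) (Real.sqrt_le_sqrt hB)) 2)

end Summit.AnomalousDissipation.AnomalousDissipation.Theorems.SawtoothPulseCascade.K1Window
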